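import Summits.Schanuel.Statement
import Literature.StrongHypotheses.Schanuel
import Literature.NumberTheory.Transcendental.ZilberProofs
import Literature.NumberTheory.Transcendental.RoyCriterionProp3Proofs
import HarnessLib
import HarnessLib.Audit.TribunalTags

/-!
# Summit `Schanuel` — bridges of the Strong-Hypothesis Library (D-0034, skeleton)

Summit-side BRIDGE file for the registry `Literature/StrongHypotheses/Schanuel.lean`: for every `H` tagged
there with `@[strong_hypothesis "Schanuel.Schanuel"]`, exactly ONE bridge tagged
`@[summit_bridge "Schanuel.Schanuel"]`, concluding the ROOT problem decl `_root_.Schanuel`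
(`Summits/Schanuel/Schanuel/Statement.lean`; `:= Literature.Periods.SchanuelConjecture`). All three bridges
are LANDED, one-line compositions of theorems already proved in `Literature/`:

* `zilberConjecture_imp_schanuel` (strictly stronger `→`): the projection
  `ZilberConjecture.schanuelConjecture : ZilberConjecture → SchanuelProperty ℂ` (`ZilberProofs.lean`,
  Bays–Kirby 2018 Thm. 1.4 `⟹`); `SchanuelProperty ℂ` is the summit up to unfolding of the `ExponentialRing ℂ`
  instance (`Iff.rfl`, as in `Summits/Schanuel/Schanuel/Theorems/EclCoreAssembly.lean`).
* `toricPeriodConjecture_iff_schanuel` (equivalent `↔`): the discharged named fact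
  `toricPeriodConjecture_iff_schanuel_holds` (`OneMotiveToric.lean`, Bertolin 2002 Cor. 1.3), whose
  right-hand side is verbatim the body of the summit.
* `royCriterionAll_iff_schanuel` (equivalent `↔`): the discharged named fact `Roy2001_iff_holds`
  (`RoyCriterionProp3Proofs.lean`, Roy 2001 §5) rank by rank, `∀ l, SchanuelRank l` being the summit by
  regrouping (`Iff.rfl`).

No PRINTED bridge is needed (stubs list empty). No summit-side conjecture def is tagged: the closed
conjecture `Prop`s under `Summits/Schanuel/Schanuel/` are Theses decls or unbuilt sketches. No new
mathematics; no `sorry`, no axiom.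
-/

noncomputable section

namespace Summit.Schanuel.StrongHypotheses

open Literature.NumberTheory.Transcendental
open Literature.StrongHypotheses.Schanuel

/-! ## Strictly stronger hypothesis (landed) -/

/-- **Zilber's conjecture ⟹ Schanuel** (landed): the Schanuel property is axiom (SP) of a Zilber field
(Zilber 2005 §1; Bays–Kirby 2018 Thm. 1.4, direction `⟹`), in tree `ZilberConjecture.schanuelConjecture`;
`SchanuelProperty ℂ` unfolds to the summit definitionally. [cite: BaysKirby2018ANT, Thm 1.4] -/
@[summit_bridge "Schanuel.Schanuel"]
theorem zilberConjecture_imp_schanuel : ZilberConjecture → _root_.Schanuel :=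
  fun h => h.schanuelConjecture

/-! ## Equivalent criteria (landed) -/

/-- **André's GPC for toric 1-motives ⇔ Schanuel** (landed): Bertolin 2002 Cor. 1.3 (André 2004 §23.4:
"the case of 1-motives without abelian part, in which case one recovers Schanuel's conjecture"), in tree
the discharged named fact `toricPeriodConjecture_iff_schanuel_holds`, whose right-hand side is verbatim
`Literature.Periods.SchanuelConjecture`. [cite: Bertolin2002, Cor. 1.3] -/
@[summit_bridge "Schanuel.Schanuel"]
theorem toricPeriodConjecture_iff_schanuel : ToricPeriodConjecture ↔ _root_.Schanuel :=
  show Literature.NumberTheory.Transcendental.toricPeriodConjecture_iff_schanuel from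
    toricPeriodConjecture_iff_schanuel_holds

/-- **Roy's criterion (all ranks) ⇔ Schanuel** (landed): Roy 2001 §5, "Conjecture 2 for rank `l` is
equivalent to Schanuel's conjecture for rank `l`", in tree the discharged named fact `Roy2001_iff_holds :
∀ l, RoyCriterion l ↔ SchanuelRank l`; the summit is `∀ l, SchanuelRank l` by regrouping its two leading
binders. [cite: Roy2001, §5 (pp. 193–194)] -/
@[summit_bridge "Schanuel.Schanuel"]
theorem royCriterionAll_iff_schanuel : RoyCriterionAll ↔ _root_.Schanuel :=
  ⟨fun h l => (show RoyCriterion l ↔ SchanuelRank l from Roy2001_iff_holds l).mp (h l),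
    fun h l => (show RoyCriterion l ↔ SchanuelRank l from Roy2001_iff_holds l).mpr (h l)⟩

end Summit.Schanuel.StrongHypotheses
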